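/-
Copyright (c) 2026. All rights reserved.
Released under Apache 2.0 license as described in the file LICENSE.
Authors: abc-iut cell, prover seat abc-iut-L4-t11 (gens 15–16; cell row «T10-6 IOTAOVER@ARCHPLUS+SUM», L4-lead m197 (2)), over
abc-iut-L4-t6's `⋉`-carrier `archGenuinePlus`, abc-iut-L4-t8's two-sided carrier `genuineTwoSidedSumLtimes`, abc-iut-w5-d144's
genuine `IotaOver` at the open-augmentation carrier and this seat's `iotaOver_sum` / `IotaOver.toLtimes`; everything BY NAME.
-/
import Literature.AnabelianGeometry.AbsoluteAnabelian.Ltimes.LogFrobeniusSettingSumIotaOver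
import Literature.AnabelianGeometry.AbsoluteAnabelian.Ltimes.LogFrobeniusMonoTelecoreContactObservablesCarriers
import HarnessLib

/-!
# [AbsTopIII] Def 5.4 (iv)/(vii): `IotaOver` at the archimedean `⋉`-carrier and at the two-sided `⋉`-carrier (DELTA #4 setting of record)

S. Mochizuki, *Topics in absolute anabelian geometry III*, J. Math. Sci. Univ. Tokyo 22 (2015) [MochizukiAbsTopIII2015]; manuscript
`paper:url-5493eb38cbb7`: Def 5.4 (iv) p. 127 (the local functors lie over `Th•[Z]`), (v) p. 127 (`Γ⃗^⋉_arc` "as a diagram in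
`TH⊞`"), (vii) p. 128 (`ι⊞_{v,ε}`), Cor 5.10 (iv) p. 147 l. 29 (one picture over all of `V(F_mod)`).

WHY THIS FILE (cell row «T10-6», L4-lead m197 (2)).  abc-iut-L4-t3's add-on `IotaOver` («`ι⊞_{v,ε}` lies over `Th•[Z]`») is an
input of the Cor 5.10 (iv)(c) observable-clause rows at the `⋉`-carriers (`Ltimes/LogFrobeniusMonoTelecoreContactObservablesCarriers`).
Here it is DISCHARGED at the setting of record:
* ★ `archGenuinePlus_iotaOver` — at abc-iut-L4-t6's carrier with genuine archimedean `TH⊞`-rows: every structure isomorphism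
  "lies over `EA`" is the identity (`archLamPlusOver`, `logOver`, `logIsoId` are `Iso.refl`) and `ι⊞` along the shell arrow is
  abc-iut-L4-t8's `iotaTimesPlus`, whose `EA`-component is the identity (`iotaTimesPlusApp.base = 𝟙`); along `k∼ →(id) k∼` and at the
  stand-in nonarchimedean places `ι⊞ = 𝟙`;
* ★★ `genuineTwoSidedSumLtimes_iotaOver` — at abc-iut-L4-t8's two-sided carrier `(genuineOpen p V₁).toLtimes ⊕ archGenuinePlus 𝔄 V₂`,
  by this seat's `iotaOver_sum` from abc-iut-w5-d144's genuine `IotaOver` restricted along `toLtimes` and the arc instance, the two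
  «`logIsoId` lies over `logOver`» compatibilities being `rfl` at both summands (`log`, `proj` identities or `logIsoId = logOver = refl`);
* hence the `hιO` binder of `genuineTwoSidedSumLtimes_cor510MonoContactObservablesCompatible_of` is discharged:
  `…_of_observables` (remaining binders: cochain — none in the geometric form —, a `TS`-datum and the two Cor 5.5 (iii) observable
  structures over `⋉`).
MODEL-LEVEL over OUR successor typing; refereed pre-IUT material; nothing here bears on [IUTchIII] Cor. 3.12; no side taken; typed ≠ proved.
-/

set_option autoImplicit false

universe u

open CategoryTheory

namespace Literature.AnabelianGeometry.AbsoluteAnabelian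

namespace LogFrobeniusSettingLtimes

/-! ## §1. `IotaOver` at the archimedean `⋉`-carrier -/

section Arch

variable (𝔄 : AutHolFieldFunctor.{u})

variable (Vmod : Type (u + 1)) (isArc : Vmod → Bool)

/-- Per-Boolean form of `archGenuinePlus_iotaOver`: for `b = true` the two edges of `Γ⃗^⋉_arc` (`k∼ →(id) k∼` and the
shell arrow `k∼ ↠ k^×`; the space-link inclusion is not an edge), for `b = false` the stand-in identities; in all cases, at
each object, both sides are composites of identities of the underlying Aut-holomorphic orbispace `𝕏` (the `EA`-component
of `iotaTimesPlus` is `𝟙 𝕏`; every structure isomorphism of the carrier is `Iso.refl`).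
[cite: MochizukiAbsTopIII2015, Def 5.4 (vii) p. 128] -/
private theorem archGenuinePlus_iotaOver_aux (b : Bool) {ν₁ ν₂ : LogVertex b} (ε : LogEdgeLtimes b ν₁ ν₂) :
    Functor.whiskerRight (archIotaPlus 𝔄 b ε)
        (Up.liftF (HolTHPlusPair.forgetTH 𝔄) ⋙ Up.liftF (HolTHPair.toEA 𝔄)) =
      (Functor.associator _ _ _ ≪≫ Functor.isoWhiskerLeft _ (archLamPlusOver 𝔄 b ν₁) ≪≫
          (archGenuinePlus 𝔄 Vmod isArc).twistOver ν₁.isPostLog).hom ≫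
        (archLamPlusOver 𝔄 b ν₂).inv := by
  ext X₀
  cases b
  · -- stand-in nonarchimedean places of THIS carrier: `ι⊞ = 𝟙`, structure isomorphisms `Iso.refl`
    cases ν₁ <;>
    · change (𝟙 (X₀.down.X) ≫ 𝟙 (X₀.down.X) : X₀.down.X ⟶ X₀.down.X) =
          (𝟙 (X₀.down.X) ≫ (𝟙 (X₀.down.X) ≫ 𝟙 (X₀.down.X))) ≫ 𝟙 (X₀.down.X)
      simp
  · -- archimedean places: the two edges of `Γ⃗^⋉_arc` (`postLogId`, `shell`); `multToSpaceLink` is excluded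
    obtain ⟨e, he⟩ := ε
    cases e
    · change (𝟙 (X₀.down.X) ≫ 𝟙 (X₀.down.X) : X₀.down.X ⟶ X₀.down.X) =
          (𝟙 (X₀.down.X) ≫ (𝟙 (X₀.down.X) ≫ 𝟙 (X₀.down.X))) ≫ 𝟙 (X₀.down.X)
      simp
    · change (𝟙 (X₀.down.X) ≫ 𝟙 (X₀.down.X) : X₀.down.X ⟶ X₀.down.X) =
          (𝟙 (X₀.down.X) ≫ (𝟙 (X₀.down.X) ≫ 𝟙 (X₀.down.X))) ≫ 𝟙 (X₀.down.X)
      simp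
    · exact False.elim he

/-- ★ **`IotaOver` HOLDS at the archimedean `⋉`-carrier `archGenuinePlus 𝔄 V isArc`**: its `ι⊞_{v,ε}` lie over `Th•[Z] = EA` — both
sides of the schema are the identity of the structure-orbispace (all structure isomorphisms of this carrier are `Iso.refl`; along the
shell arrow `ι⊞ = iotaTimesPlus` has `EA`-component `𝟙`). [cite: MochizukiAbsTopIII2015, Def 5.4 (vii) p. 128] -/
theorem archGenuinePlus_iotaOver : (archGenuinePlus 𝔄 Vmod isArc).IotaOver :=
  fun v _ _ ε => archGenuinePlus_iotaOver_aux 𝔄 Vmod isArc (isArc v) ε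

/-- «`logIsoId` lies over `logOver`» at the arc carrier: both are `Iso.refl` (and `log = 𝟭`). [cite: MochizukiAbsTopIII2015, Def 5.4 (ii) p. 125] -/
theorem archGenuinePlus_proj_map_logIsoId (X : (archGenuinePlus 𝔄 Vmod isArc).X) :
    (archGenuinePlus 𝔄 Vmod isArc).proj.map ((archGenuinePlus 𝔄 Vmod isArc).logIsoId.hom.app X) =
      (archGenuinePlus 𝔄 Vmod isArc).logOver.hom.app X := by
  change (Up.liftF (HolTFPair.toEA 𝔄)).map (𝟙 X) = 𝟙 _
  exact (Up.liftF (HolTFPair.toEA 𝔄)).map_id X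

end Arch

/-! ## §2. `IotaOver` at the two-sided `⋉`-carrier (the DELTA #4 setting of record) -/

section TwoSided

open LogFrobeniusSetting AbsTopIII

variable (p : ℕ) [Fact p.Prime] (𝔄 : AutHolFieldFunctor.{0}) (V₁ V₂ : Type 1)

/-- «`logIsoId` lies over `logOver`» at the restricted open carrier: `proj = log = 𝟭`, both isomorphisms `Iso.refl`.
[cite: MochizukiAbsTopIII2015, Def 5.4 (ii) p. 125] -/
theorem openLtimes_proj_map_logIsoId (X : (genuineOpen p V₁).toLtimes.X) :
    (genuineOpen p V₁).toLtimes.proj.map ((genuineOpen p V₁).toLtimes.logIsoId.hom.app X) =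
      (genuineOpen p V₁).toLtimes.logOver.hom.app X := rfl

/-- ★★ **`IotaOver` HOLDS at the two-sided `⋉`-carrier `genuineTwoSidedSumLtimes p 𝔄 V₁ V₂`** — summand-wise by `iotaOver_sum`:
abc-iut-w5-d144's genuine `IotaOver` at `genuineOpen p V₁` restricted along `toLtimes` (`iotaOver_openLtimes`) ⊕ `archGenuinePlus_iotaOver`.
[cite: MochizukiAbsTopIII2015, Def 5.4 (vii) p. 128] -/
theorem genuineTwoSidedSumLtimes_iotaOver : (genuineTwoSidedSumLtimes p 𝔄 V₁ V₂).IotaOver :=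
  iotaOver_sum (iotaOver_openLtimes p V₁) (archGenuinePlus_iotaOver 𝔄 V₂ (fun _ => true))
    (openLtimes_proj_map_logIsoId p V₁) (archGenuinePlus_proj_map_logIsoId 𝔄 V₂ (fun _ => true))

/-- ★★ **Cor 5.10 (iv)(c), observable clause, at the two-sided `⋉`-carrier FROM THE OBSERVABLE STRUCTURES ONLY** (+ the orientation
cochain for a general `𝔄`): the `IotaOver` binder of `genuineTwoSidedSumLtimes_cor510MonoContactObservablesCompatible_of` discharged.
[cite: MochizukiAbsTopIII2015, Cor 5.10 (iv)(c) p. 148] -/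
theorem genuineTwoSidedSumLtimes_cor510MonoContactObservablesCompatible_of_observables [Nonempty (V₁ ⊕ V₂)] (c : 𝔄.EA → ℝ)
    (hc : ∀ X : 𝔄.EA, c X = 1 ∨ c X = -1)
    (hcob : ∀ {X Y : 𝔄.EA} (f : X ⟶ Y), AutHolFieldFunctor.transitionSign f = c X * c Y)
    (TS : (genuineTwoSidedSumLtimes p 𝔄 V₁ V₂).TSHomotopies)
    (hplus : (genuineTwoSidedSumLtimes p 𝔄 V₁ V₂).Cor55Observables)
    (hts : (genuineTwoSidedSumLtimes p 𝔄 V₁ V₂).Cor55ObservablesTS TS) :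
    (genuineTwoSidedSumLtimes p 𝔄 V₁ V₂).Cor510MonoContactObservablesCompatible TS :=
  genuineTwoSidedSumLtimes_cor510MonoContactObservablesCompatible_of p 𝔄 V₁ V₂ c hc hcob
    (genuineTwoSidedSumLtimes_iotaOver p 𝔄 V₁ V₂) TS hplus hts

end TwoSided

end LogFrobeniusSettingLtimes

/-! ## §2b. The geometric case -/

namespace HolRS

open LogFrobeniusSetting LogFrobeniusSettingLtimes

/-- ★★ at the geometric Aut-holomorphic field functor: Cor 5.10 (iv)(c), observable clause, at the two-sided `⋉`-carrier from a
`TS`-datum and the two Cor 5.5 (iii) observable structures ONLY (`V₁ ⊕ V₂ ≠ ∅`) — cochain and `IotaOver` discharged.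
[cite: MochizukiAbsTopIII2015, Cor 5.10 (iv)(c) p. 148] -/
theorem cor510MonoContactObservablesCompatible_genuineTwoSidedSumLtimes_geometric_of_observables (p : ℕ) [Fact p.Prime]
    (Q : ObjectProperty HolRS) (V₁ V₂ : Type 1) [Nonempty (V₁ ⊕ V₂)]
    (TS : (genuineTwoSidedSumLtimes p (geometricAutHolFieldFunctor Q) V₁ V₂).TSHomotopies)
    (hplus : (genuineTwoSidedSumLtimes p (geometricAutHolFieldFunctor Q) V₁ V₂).Cor55Observables)
    (hts : (genuineTwoSidedSumLtimes p (geometricAutHolFieldFunctor Q) V₁ V₂).Cor55ObservablesTS TS) :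
    (genuineTwoSidedSumLtimes p (geometricAutHolFieldFunctor Q) V₁ V₂).Cor510MonoContactObservablesCompatible TS :=
  cor510MonoContactObservablesCompatible_genuineTwoSidedSumLtimes_geometric_of p Q V₁ V₂
    (genuineTwoSidedSumLtimes_iotaOver p _ V₁ V₂) TS hplus hts

end HolRS

end Literature.AnabelianGeometry.AbsoluteAnabelian
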